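import Literature.NumberTheory.EllipticCurves.IwasawaAlgebraRankOneIdealProofs
import Literature.NumberTheory.EllipticCurves.IwasawaAlgebraPromotionProofs
import HarnessLib

/-!
# Rigidity of `Λ`-valued functionals with finite cokernel (module theory over `Λ = ℤ_p⟦T⟧`): two
# «Coleman-type» maps `M → Λ` differ by a UNIT

Cell `bsd-2adic`, seat `bsd-2adic-conv-1` GEN 31.  Mathlib-style commutative algebra over the Iwasawa algebra
`Λ = ℤ_[p]⟦T⟧ = Literature.NumberTheory.EllipticCurves.IwasawaAlgebra p`; THEOREMS ONLY (no definition, no named fact,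
no instance).  Nothing about elliptic curves is asserted.

* `IwasawaAlgebra.exists_isUnit_mul_eq_of_finite_cokernel` — for `Λ`-linear `φ ψ : M → Λ` with the kernel of `φ` TORSION and both
  cokernels FINITE there is a unit `u ∈ Λˣ` with `ψ = u · φ`.  (Reason: `φ(y)·ψ(x) = φ(x)·ψ(y)` because `φ(y)x − φ(x)y ∈ ker φ`
  is torsion and `Λ` is a domain; so `ψ = (a/b)·φ` in `Frac Λ`; an ideal of finite index contains `p^N` AND `T^N`, and `p` is a prime
  of `Λ` not dividing `T`, whence `a ∣ b` and `b ∣ a`.)  No UFD structure of `Λ` is used.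
* `IwasawaAlgebra.exists_unit_mul_C_pow_mul_eq_of_finite_cokernel` — the consumer shape: if moreover `ψ x₀ = u' · p^n · L`, then
  `φ x₀ = u · p^n · L` for a unit `u`.

WHY (use).  Kato's `F⁻`-Coleman map at an ordinary prime is an injection-up-to-`p`-power-torsion `𝐇¹_loc(T) ⧸ 𝐇¹_loc(T') ↪ Λ` with
FINITE cokernel (Astérisque 295, Thm 16.4 / Prop 17.11); two such maps on the same carrier (e.g. the Coleman maps of a curve and of a
locally isomorphic twist, read on one local carrier) therefore differ by a unit of `Λ`, so a first reciprocity law `Col(z) = unit · pⁿ · L`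
read through either has the same shape.  (Line `kato-determinant-greenberg-two` of crux `OrdLambdaHalfAtTwo`, stub 4‴, field
`PinnedKatoCore.recA`; K4 crux 202, F1-Col.)

## References
* K. Kato, Astérisque 295 (2004), Thm 16.4 (p. 271), Prop 17.11 (p. 277): `𝔏_η` induces an injection with finite cokernel. [Kato2004Asterisque]
* J. Neukirch, A. Schmidt, K. Wingberg, *Cohomology of Number Fields*, Ch. V §1 (5.1.4) Remark 4 (finite = pseudo-null over `Λ`;
  a finite `Λ`-module is killed by a power of the maximal ideal). [NeukirchSchmidtWingberg2008]
* L. C. Washington, GTM 83, §13.1–13.2 (`p` prime in `Λ`, `Λ/(p) ≅ 𝔽_p⟦T⟧`). [Washington1997]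
-/

noncomputable section

open scoped Classical

namespace Literature.NumberTheory.EllipticCurves

namespace IwasawaAlgebra

variable {p : ℕ} [Fact p.Prime]

/-! ### §1 Finite-index ideals of `Λ` contain a power of `T`; `p ∤ T` -/

/-- `Λ = ℤ_p⟦T⟧` is infinite (it contains `ℤ_p ⊇ ℤ`). [cite: Washington1997, §13.1] -/
theorem infinite : Infinite (IwasawaAlgebra p) :=
  haveI : Infinite ℤ_[p] := Infinite.of_injective (Nat.cast : ℕ → ℤ_[p]) Nat.cast_injective
  Infinite.of_injective (PowerSeries.C : ℤ_[p] → IwasawaAlgebra p) fun a b h ↦ by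
    simpa using congrArg (PowerSeries.constantCoeff) h

/-- An ideal of `Λ` of finite index contains a power of `T` (the powers of `T` repeat modulo the ideal and `1 − T^k` is a unit).
[cite: NeukirchSchmidtWingberg2008, Ch. V §1 (5.1.4) Remark 4] -/
theorem exists_X_pow_mem_of_finite_quotient (𝔟 : Ideal (IwasawaAlgebra p)) [Finite (IwasawaAlgebra p ⧸ 𝔟)] :
    ∃ N : ℕ, (PowerSeries.X : IwasawaAlgebra p) ^ N ∈ 𝔟 := by
  obtain ⟨i, j, hij, h⟩ := Finite.exists_ne_map_eq_of_infinite
    (fun n : ℕ ↦ Ideal.Quotient.mk 𝔟 ((PowerSeries.X : IwasawaAlgebra p) ^ n))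
  -- w.l.o.g. `i < j`
  wlog hlt : i < j generalizing i j
  · exact this j i hij.symm h.symm (lt_of_le_of_ne (not_lt.mp hlt) hij.symm)
  obtain ⟨k, rfl⟩ := Nat.exists_eq_add_of_lt hlt
  refine ⟨i, ?_⟩
  -- `X^i - X^(i+k+1) = X^i * (1 - X^(k+1)) ∈ 𝔟`, and `1 - X^(k+1)` is a unit
  have hmem : (PowerSeries.X : IwasawaAlgebra p) ^ i * (1 - PowerSeries.X ^ (k + 1)) ∈ 𝔟 := by
    have : (PowerSeries.X : IwasawaAlgebra p) ^ i - PowerSeries.X ^ (i + k + 1) ∈ 𝔟 := by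
      rw [← Ideal.Quotient.eq]; exact h
    convert this using 1; ring
  have hunit : IsUnit (1 - (PowerSeries.X : IwasawaAlgebra p) ^ (k + 1)) := by
    rw [PowerSeries.isUnit_iff_constantCoeff]; simp
  obtain ⟨v, hv⟩ := hunit
  have := 𝔟.mul_mem_right (↑v⁻¹ : IwasawaAlgebra p) hmem
  rwa [← hv, mul_assoc, Units.mul_inv, mul_one] at this

/-- `p ∤ T` in `Λ` (compare the coefficients of `T`). [cite: Washington1997, §13.1] -/
theorem not_natCast_dvd_X : ¬ ((p : IwasawaAlgebra p) ∣ (PowerSeries.X : IwasawaAlgebra p)) := by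
  rintro ⟨g, hg⟩
  have h1 := congrArg (PowerSeries.coeff 1) hg
  rw [PowerSeries.coeff_one_X, ← map_natCast (PowerSeries.C (R := ℤ_[p])), PowerSeries.coeff_C_mul] at h1
  have hp : ¬ IsUnit ((p : ℕ) : ℤ_[p]) := PadicInt.prime_p.not_unit
  exact hp (IsUnit.of_mul_eq_one _ h1.symm)

/-- In `Λ`: if `a ∣ b·p^N` and `a ∣ b·T^N` with `a ≠ 0` then `a ∣ b` (`p` is prime and does not divide `T`; no UFD structure needed).
[cite: Washington1997, §13.1] -/
theorem dvd_of_dvd_mul_natCast_pow_of_dvd_mul_X_pow {a b : IwasawaAlgebra p} (ha : a ≠ 0) {N : ℕ}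
    (hp : a ∣ b * (p : IwasawaAlgebra p) ^ N) (hX : a ∣ b * PowerSeries.X ^ N) : a ∣ b := by
  obtain ⟨e, he⟩ := hp
  obtain ⟨d, hd⟩ := hX
  -- `e · T^N = d · p^N`
  have hed : e * PowerSeries.X ^ N = d * (p : IwasawaAlgebra p) ^ N := by
    have : a * (e * PowerSeries.X ^ N) = a * (d * (p : IwasawaAlgebra p) ^ N) := by
      calc a * (e * PowerSeries.X ^ N) = (a * e) * PowerSeries.X ^ N := by ring
        _ = b * (p : IwasawaAlgebra p) ^ N * PowerSeries.X ^ N := by rw [← he]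
        _ = (b * PowerSeries.X ^ N) * (p : IwasawaAlgebra p) ^ N := by ring
        _ = (a * d) * (p : IwasawaAlgebra p) ^ N := by rw [← hd]
        _ = a * (d * (p : IwasawaAlgebra p) ^ N) := by ring
    exact mul_left_cancel₀ ha this
  have hpN : (p : IwasawaAlgebra p) ^ N ∣ e := by
    refine (prime_natCast (p := p)).pow_dvd_of_dvd_mul_right N ?_ ⟨d, by rw [hed]; ring⟩
    exact fun h ↦ not_natCast_dvd_X (p := p) ((prime_natCast (p := p)).dvd_of_dvd_pow h)
  obtain ⟨e', rfl⟩ := hpN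
  refine ⟨e', ?_⟩
  have hpN0 : (p : IwasawaAlgebra p) ^ N ≠ 0 := pow_ne_zero _ (prime_natCast (p := p)).ne_zero
  have : b * (p : IwasawaAlgebra p) ^ N = (a * e') * (p : IwasawaAlgebra p) ^ N := by rw [he]; ring
  exact mul_right_cancel₀ hpN0 this

/-! ### §2 Rigidity: two functionals with finite cokernel differ by a unit -/

variable {M : Type*} [AddCommGroup M] [Module (IwasawaAlgebra p) M]

/-- **Proportionality.**  For `Λ`-linear `φ ψ : M → Λ` with `ker φ` torsion: `φ(y)·ψ(x) = φ(x)·ψ(y)` for all `x, y`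
(`φ(y)x − φ(x)y ∈ ker φ` is torsion, and `ψ` of a torsion element vanishes in the domain `Λ`). [cite: BourbakiAC5to7, Ch. VII §4 no. 1] -/
theorem mul_eq_mul_of_ker_torsion (φ ψ : M →ₗ[IwasawaAlgebra p] IwasawaAlgebra p)
    (hφ : ∀ x, φ x = 0 → ∃ r : IwasawaAlgebra p, r ≠ 0 ∧ r • x = 0) (x y : M) :
    φ y * ψ x = φ x * ψ y := by
  obtain ⟨r, hr, hrz⟩ := hφ (φ y • x - φ x • y) (by simp [mul_comm])
  have : r * ψ (φ y • x - φ x • y) = 0 := by rw [← smul_eq_mul, ← map_smul, hrz, map_zero]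
  rcases mul_eq_zero.mp this with h | h
  · exact absurd h hr
  · simpa [sub_eq_zero, smul_eq_mul] using h

/-- **Rigidity of finite-cokernel functionals.**  For `Λ`-linear `φ ψ : M → Λ` with `ker φ` TORSION and both cokernels FINITE there is a
unit `u ∈ Λˣ` with `ψ x = u · φ x` for every `x`. [cite: Kato2004Asterisque, Thm 16.4 and Prop 17.11 (shape: injection with finite cokernel)]
[cite: NeukirchSchmidtWingberg2008, Ch. V §1 (5.1.4) Remark 4] -/
theorem exists_isUnit_mul_eq_of_finite_cokernel (φ ψ : M →ₗ[IwasawaAlgebra p] IwasawaAlgebra p)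
    (hφ : ∀ x, φ x = 0 → ∃ r : IwasawaAlgebra p, r ≠ 0 ∧ r • x = 0)
    [Finite (IwasawaAlgebra p ⧸ LinearMap.range φ)] [Finite (IwasawaAlgebra p ⧸ LinearMap.range ψ)] :
    ∃ u : (IwasawaAlgebra p)ˣ, ∀ x, ψ x = (u : IwasawaAlgebra p) * φ x := by
  haveI := infinite (p := p)
  -- `φ ≠ 0` and `ψ ≠ 0` (finite cokernel in an infinite ring)
  have hne : ∀ χ : M →ₗ[IwasawaAlgebra p] IwasawaAlgebra p, Finite (IwasawaAlgebra p ⧸ LinearMap.range χ) → ∃ y, χ y ≠ 0 := by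
    intro χ hfin
    by_contra! h0
    have hr : LinearMap.range χ = ⊥ := by
      rw [eq_bot_iff]; rintro _ ⟨y, rfl⟩; simp [h0 y]
    rw [hr] at hfin
    haveI : Finite (IwasawaAlgebra p) :=
      Finite.of_equiv _ (Submodule.quotEquivOfEqBot (⊥ : Submodule (IwasawaAlgebra p) (IwasawaAlgebra p)) rfl).toEquiv
    exact not_finite (IwasawaAlgebra p)
  obtain ⟨y₀, hb⟩ := hne φ ‹_›
  set a := ψ y₀ with ha_def
  set b := φ y₀ with hb_def
  have hprop : ∀ x, b * ψ x = a * φ x := fun x ↦ by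
    rw [hb_def, ha_def, mul_eq_mul_of_ker_torsion φ ψ hφ x y₀, mul_comm]
  -- `a ≠ 0`
  have ha : a ≠ 0 := by
    intro ha0
    obtain ⟨y₁, hy₁⟩ := hne ψ ‹_›
    have := hprop y₁
    rw [ha0, zero_mul, mul_eq_zero] at this
    rcases this with h | h
    · exact hb h
    · exact hy₁ h
  -- powers of `p` and `T` in both ranges
  obtain ⟨N₁, hN₁⟩ := exists_natCast_pow_mem_of_finite_quotient (p := p) (LinearMap.range φ)
  obtain ⟨N₂, hN₂⟩ := exists_X_pow_mem_of_finite_quotient (LinearMap.range φ)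
  obtain ⟨N₃, hN₃⟩ := exists_natCast_pow_mem_of_finite_quotient (p := p) (LinearMap.range ψ)
  obtain ⟨N₄, hN₄⟩ := exists_X_pow_mem_of_finite_quotient (LinearMap.range ψ)
  obtain ⟨x₁, hx₁⟩ := LinearMap.mem_range.mp hN₁
  obtain ⟨x₂, hx₂⟩ := LinearMap.mem_range.mp hN₂
  obtain ⟨x₃, hx₃⟩ := LinearMap.mem_range.mp hN₃
  obtain ⟨x₄, hx₄⟩ := LinearMap.mem_range.mp hN₄
  -- `b ∣ a p^N₁`, `b ∣ a T^N₂`, `a ∣ b p^N₃`, `a ∣ b T^N₄`; raise all exponents to `N`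
  set N := N₁ + N₂ + N₃ + N₄ with hN
  have hdvd : ∀ {c d q : IwasawaAlgebra p} {m : ℕ}, m ≤ N → c ∣ d * q ^ m → c ∣ d * q ^ N := by
    intro c d q m hm h
    obtain ⟨k, hk⟩ := Nat.exists_eq_add_of_le hm
    rw [hk, pow_add, ← mul_assoc]
    exact h.mul_right _
  have h1 : b ∣ a * (p : IwasawaAlgebra p) ^ N := hdvd (m := N₁) (by omega) ⟨ψ x₁, by rw [← hx₁, ← hprop x₁]⟩
  have h2 : b ∣ a * PowerSeries.X ^ N := hdvd (m := N₂) (by omega) ⟨ψ x₂, by rw [← hx₂, ← hprop x₂]⟩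
  have h3 : a ∣ b * (p : IwasawaAlgebra p) ^ N := hdvd (m := N₃) (by omega) ⟨φ x₃, by rw [← hx₃, hprop x₃]⟩
  have h4 : a ∣ b * PowerSeries.X ^ N := hdvd (m := N₄) (by omega) ⟨φ x₄, by rw [← hx₄, hprop x₄]⟩
  have hba : b ∣ a := dvd_of_dvd_mul_natCast_pow_of_dvd_mul_X_pow hb h1 h2
  have hab : a ∣ b := dvd_of_dvd_mul_natCast_pow_of_dvd_mul_X_pow ha h3 h4
  obtain ⟨f, hf⟩ := hba
  obtain ⟨g, hg⟩ := hab
  -- `f g = 1`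
  have hfg : f * g = 1 := by
    have : b * (f * g) = b * 1 := by
      calc b * (f * g) = (b * f) * g := by ring
        _ = a * g := by rw [← hf]
        _ = b := hg.symm
        _ = b * 1 := (mul_one b).symm
    exact mul_left_cancel₀ hb this
  refine ⟨Units.mkOfMulEqOne f g hfg, fun x ↦ ?_⟩
  have := hprop x
  rw [hf, mul_assoc] at this
  simpa using mul_left_cancel₀ hb this

/-- Symmetric form: with BOTH kernels torsion, `φ` and `ψ` generate the same values up to ONE unit (`ψ = u φ`, `φ = u⁻¹ ψ`).
[cite: Kato2004Asterisque, Prop 17.11] -/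
theorem exists_isUnit_mul_eq_of_finite_cokernel' (φ ψ : M →ₗ[IwasawaAlgebra p] IwasawaAlgebra p)
    (hφ : ∀ x, φ x = 0 → ∃ r : IwasawaAlgebra p, r ≠ 0 ∧ r • x = 0)
    [Finite (IwasawaAlgebra p ⧸ LinearMap.range φ)] [Finite (IwasawaAlgebra p ⧸ LinearMap.range ψ)] :
    ∃ u : (IwasawaAlgebra p)ˣ, (∀ x, ψ x = (u : IwasawaAlgebra p) * φ x) ∧ ∀ x, φ x = (↑u⁻¹ : IwasawaAlgebra p) * ψ x := by
  obtain ⟨u, hu⟩ := exists_isUnit_mul_eq_of_finite_cokernel φ ψ hφ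
  exact ⟨u, hu, fun x ↦ by rw [hu, ← mul_assoc, Units.inv_mul, one_mul]⟩

/-! ### §3 The consumer shape: a reciprocity law read through either Coleman-type map -/

/-- A kernel «killed by a power of `p`» (the shape `∃ k, C(p^k) • q = 0` of the tree's Coleman-map binders) is torsion.
[cite: Kato2004Asterisque, Thm 16.4] -/
theorem ker_torsion_of_C_pow_smul_eq_zero (φ : M →ₗ[IwasawaAlgebra p] IwasawaAlgebra p)
    (hφ : ∀ q, φ q = 0 → ∃ k : ℕ, (PowerSeries.C ((p : ℤ_[p]) ^ k) : IwasawaAlgebra p) • q = 0) :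
    ∀ x, φ x = 0 → ∃ r : IwasawaAlgebra p, r ≠ 0 ∧ r • x = 0 := fun x hx ↦ by
  obtain ⟨k, hk⟩ := hφ x hx
  refine ⟨_, ?_, hk⟩
  rw [map_pow, map_natCast]
  exact pow_ne_zero _ (prime_natCast (p := p)).ne_zero

/-- **First reciprocity law through the other Coleman map.**  If `φ, ψ : M → Λ` both have `p`-power-torsion kernel (only `φ`'s is used)
and finite cokernel, and `ψ x₀ = u' · C(p^n) · L`, then `φ x₀ = u · C(p^n) · L` for some unit `u` (namely `u = v⁻¹ u'` for the rigidity
unit `v`). [cite: Kato2004Asterisque, Thm 16.6 (2) and Prop 17.11] -/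
theorem exists_unit_mul_C_pow_mul_eq_of_finite_cokernel (φ ψ : M →ₗ[IwasawaAlgebra p] IwasawaAlgebra p)
    (hφ : ∀ q, φ q = 0 → ∃ k : ℕ, (PowerSeries.C ((p : ℤ_[p]) ^ k) : IwasawaAlgebra p) • q = 0)
    [Finite (IwasawaAlgebra p ⧸ LinearMap.range φ)] [Finite (IwasawaAlgebra p ⧸ LinearMap.range ψ)]
    {x₀ : M} {u' : (IwasawaAlgebra p)ˣ} {n : ℕ} {L : IwasawaAlgebra p}
    (hψ : ψ x₀ = (u' : IwasawaAlgebra p) * PowerSeries.C ((p : ℤ_[p]) ^ n) * L) :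
    ∃ u : (IwasawaAlgebra p)ˣ, φ x₀ = (u : IwasawaAlgebra p) * PowerSeries.C ((p : ℤ_[p]) ^ n) * L := by
  obtain ⟨v, -, hv⟩ := exists_isUnit_mul_eq_of_finite_cokernel' φ ψ (ker_torsion_of_C_pow_smul_eq_zero φ hφ)
  exact ⟨v⁻¹ * u', by rw [hv x₀, hψ, Units.val_mul]; ring⟩

end IwasawaAlgebra

end Literature.NumberTheory.EllipticCurves

end
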